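import Summits.CriticalPhenomena.Ising3D.TaylorTableOddHeadDeltaMerged
import Mathlib.Tactic.Linarith
import HarnessLib

/-!
# The TABLE layer of a derivative certificate, XXXII: part checks against LITERAL Taylor-model tables and GROUP parts (the kernel-cost layout)
(cell `pub-ising3x`, seat boot-1 gen 10; gate (g2) — the replay layout of the δ-expanded head certificates; measurements HEAD-DELTA.md §8.1)

HONEST FRAMING: lottery ticket; floor = tightest certified 3D Ising CFT bounds; no exact-solution
claim without a proof. Island framing: certified exclusion region at stated derivative order and
assumptions; not a determination of the 3D Ising critical exponents beyond that.

MEASURED (boot-1 g10, HEAD-DELTA.md §8.1): the kernel time of ONE `decide` grows roughly quadratically with the work inside it, while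
separate declarations are additive; a one-term odd part costs ≈ 4 s flat in the level once the three Taylor-model tables are LITERALS
(validated once per cell, 28 s each), and a file may hold ≤ 512 KB. Hence the replay layout: one-term (or few-term) parts checked against
literal tables, and GROUP parts whose claims dominate the summed claims of consecutive small parts, so that the final sign test runs on few
parts. This file supplies exactly the glue that makes that layout SOUND with the landed definitions unchanged:
* `oddPartOKL R C tS tP tM p` — `oddHeadPartOKΔ` with the three tables as ARGUMENTS; `oddHeadPartOKΔ_eq_oddPartOKL` (rfl) and
  `oddHeadPartOKΔ_of_tables` (rewrite by the three kernel-checked table equalities); `evenPartOKL` / `evenHeadPartOKΔ_of_table` likewise;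
* interval-polynomial bookkeeping: `addI_assoc`, `subsetI_trans`, `subsetI_addI` (containment is monotone under `addI`), their triple forms,
  `headPolyTM_append` (the computed head polynomial of a concatenated slice is the `addI` of the pieces), `famTriple_append`;
* **`oddHeadPartOKΔ_of_group`**: consecutive parts `ps` (a chain from `g.t0` of total length `g.count`, the cheap Boolean `groupTiles`) that
  each pass `oddPartOKL`, and whose summed claims are contained in the claims of `g` (`groupClaimsOK`, one cheap decide), make the group part
  `g` pass `oddHeadPartOKΔ` — as a THEOREM, without the kernel ever evaluating a many-term part. The existing finals
  (`oddHeadFinalOKΔ` / `oddHeadFinalOKΔM`) and cell theorems then apply verbatim to the short list of group parts.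
Elementary given the tree (list induction). [folklore]
-/

namespace Summit.CriticalPhenomena.Ising3D

open Literature.Analysis.ValidatedNumerics Literature.Analysis.ValidatedNumerics.PolyMP
open Literature.Analysis.ValidatedNumerics.NumericsMP (MI)
open Literature.MathematicalPhysics.QuantumFieldTheory.ConformalBootstrap3D
open Literature.MathematicalPhysics.QuantumFieldTheory.ConformalBootstrap3D.HRTM (rowEntry pivOK)

/-! ### Part checks with the Taylor-model tables as arguments -/

/-- `oddHeadPartOKΔ` with the three Taylor-model tables `tS, tP, tM` passed in (in a replay: per-level LITERALS, validated once per cell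
by `C.tmsS R.S t₁ t₂ = tS` etc.). [folklore] -/
def oddPartOKL (R : OddHeadRowsΔ) (C : EvenCellTM) (tS tP tM : List (List IPoly)) (p : HeadPartOdd) : Bool :=
  let sl := (C.F.drop p.t0).take p.count
  subset3 (famTriple R.S (R.rows 0 0) (R.rows 0 1) (R.rows 0 2) tS C sl) p.P3 &&
    subset3 (famTriple R.S (R.rows 1 0) (R.rows 1 1) (R.rows 1 2) tP C sl) p.P4 &&
    subset3 (famTriple R.S (R.rows 2 0) (R.rows 2 1) (R.rows 2 2) tP C sl) p.P5 &&
    subsetI (headPolyTM R.S (R.rows 3 0) tM C.nF C.ℓ C.ctr sl) p.P0 &&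
    subset3 (famTriple R.S (R.rows 4 0) (R.rows 4 1) (R.rows 4 2) tP C sl) p.Pt

/-- The landed part check IS `oddPartOKL` at the computed tables. [folklore] -/
theorem oddHeadPartOKΔ_eq_oddPartOKL (R : OddHeadRowsΔ) (C : EvenCellTM) (t₁ t₂ : ℚ) (p : HeadPartOdd) :
    oddHeadPartOKΔ R C t₁ t₂ p = oddPartOKL R C (C.tmsS R.S t₁ t₂) (C.tmsP R.S t₁ t₂) (C.tmsM R.S t₁ t₂) p := rfl

/-- **Odd part check from literal tables**: three kernel-checked table equalities and the literal-table check give the landed check.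
[folklore] -/
theorem oddHeadPartOKΔ_of_tables {R : OddHeadRowsΔ} {C : EvenCellTM} {t₁ t₂ : ℚ} {tS tP tM : List (List IPoly)}
    (hS : C.tmsS R.S t₁ t₂ = tS) (hP : C.tmsP R.S t₁ t₂ = tP) (hM : C.tmsM R.S t₁ t₂ = tM) {p : HeadPartOdd}
    (h : oddPartOKL R C tS tP tM p = true) : oddHeadPartOKΔ R C t₁ t₂ p = true := by
  rw [oddHeadPartOKΔ_eq_oddPartOKL, hS, hP, hM]; exact h

/-- `evenHeadPartOKΔ` with the Taylor-model table passed in. [folklore] -/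
def evenPartOKL (R : HeadRowsΔ) (C : EvenCellTM) (tms : List (List IPoly)) (p : HeadPart3) : Bool :=
  headPartOKWith tms R.rows0 C p.ord0 && headPartOKWith tms R.rows1 C p.ord1 && headPartOKWith tms R.rows2 C p.ord2

/-- The landed even part check IS `evenPartOKL` at the computed table. [folklore] -/
theorem evenHeadPartOKΔ_eq_evenPartOKL (R : HeadRowsΔ) (C : EvenCellTM) (p : HeadPart3) :
    evenHeadPartOKΔ R C p = evenPartOKL R C (HRTM.rows R.S C.ctr C.ℓ C.e C.D C.nF) p := rfl

/-- **Even part check from a literal table.** [folklore] -/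
theorem evenHeadPartOKΔ_of_table {R : HeadRowsΔ} {C : EvenCellTM} {tms : List (List IPoly)}
    (ht : HRTM.rows R.S C.ctr C.ℓ C.e C.D C.nF = tms) {p : HeadPart3} (h : evenPartOKL R C tms p = true) :
    evenHeadPartOKΔ R C p = true := by
  rw [evenHeadPartOKΔ_eq_evenPartOKL, ht]; exact h

/-! ### Interval-polynomial bookkeeping: `addI` associativity, containment transitivity and monotonicity -/

/-- `addI P [] = P`. [folklore] -/
theorem addI_nil_right : ∀ P : IPoly, addI P [] = P
  | [] => rfl
  | _ :: _ => rfl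

/-- `addI` is associative. [folklore] -/
theorem addI_assoc : ∀ P Q T : IPoly, addI (addI P Q) T = addI P (addI Q T)
  | [], Q, T => by simp [addI]
  | I :: P, [], T => by simp [addI]
  | I :: P, J :: Q, [] => by simp [addI, addI_nil_right]
  | I :: P, J :: Q, K :: T => by
      simp only [addI, List.cons.injEq]
      exact ⟨by simp only [MI.add, add_assoc], addI_assoc P Q T⟩

/-- Containment of interval polynomials is transitive. [folklore] -/
theorem subsetI_trans : ∀ {P Q T : IPoly}, subsetI P Q = true → subsetI Q T = true → subsetI P T = true
  | [], [], [], _, _ => rfl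
  | [], [], _ :: _, _, h => by simp [subsetI] at h
  | [], _ :: _, _, h, _ => by simp [subsetI] at h
  | _ :: _, [], _, h, _ => by simp [subsetI] at h
  | _ :: _, _ :: _, [], _, h => by simp [subsetI] at h
  | I :: P, J :: Q, K :: T, h1, h2 => by
      simp only [subsetI, Bool.and_eq_true, decide_eq_true_eq] at h1 h2 ⊢
      exact ⟨⟨le_trans h2.1.1 h1.1.1, le_trans h1.1.2 h2.1.2⟩, subsetI_trans h1.2 h2.2⟩

/-- Containment is monotone under `addI`. [folklore] -/
theorem subsetI_addI : ∀ {P P' Q Q' : IPoly}, subsetI P P' = true → subsetI Q Q' = true →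
    subsetI (addI P Q) (addI P' Q') = true
  | [], [], Q, Q', _, hQ => by simpa [addI] using hQ
  | [], _ :: _, _, _, h, _ => by simp [subsetI] at h
  | _ :: _, [], _, _, h, _ => by simp [subsetI] at h
  | I :: P, I' :: P', [], [], hP, _ => by simpa [addI] using hP
  | _ :: _, _ :: _, [], _ :: _, _, h => by simp [subsetI] at h
  | _ :: _, _ :: _, _ :: _, [], _, h => by simp [subsetI] at h
  | I :: P, I' :: P', J :: Q, J' :: Q', hP, hQ => by
      simp only [subsetI, Bool.and_eq_true, decide_eq_true_eq] at hP hQ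
      simp only [addI, subsetI, Bool.and_eq_true, decide_eq_true_eq, MI.add]
      exact ⟨⟨by linarith [hP.1.1, hQ.1.1], by linarith [hP.1.2, hQ.1.2]⟩, subsetI_addI hP.2 hQ.2⟩

/-- Triple containment is transitive. [folklore] -/
theorem subset3_trans {A B D : ITriple} (h1 : subset3 A B = true) (h2 : subset3 B D = true) : subset3 A D = true := by
  simp only [subset3, Bool.and_eq_true] at h1 h2 ⊢
  exact ⟨⟨subsetI_trans h1.1.1 h2.1.1, subsetI_trans h1.1.2 h2.1.2⟩, subsetI_trans h1.2 h2.2⟩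

/-- Triple containment is monotone under `add3`. [folklore] -/
theorem subset3_add3 {A A' B B' : ITriple} (h1 : subset3 A A' = true) (h2 : subset3 B B' = true) :
    subset3 (add3 A B) (add3 A' B') = true := by
  simp only [subset3, Bool.and_eq_true] at h1 h2 ⊢
  simp only [add3]
  exact ⟨⟨subsetI_addI h1.1.1 h2.1.1, subsetI_addI h1.1.2 h2.1.2⟩, subsetI_addI h1.2 h2.2⟩

/-! ### Computed head polynomials of concatenated slices -/

/-- **The computed head polynomial of a concatenated slice is the `addI` of the pieces.** [folklore] -/
theorem headPolyTM_append (S : ℕ) (rows : List IPoly) (tms : List (List IPoly)) (nF ℓ : ℕ) (ctr : ℚ) :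
    ∀ A B : List (ℕ × ℕ), headPolyTM S rows tms nF ℓ ctr (A ++ B) =
      addI (headPolyTM S rows tms nF ℓ ctr A) (headPolyTM S rows tms nF ℓ ctr B)
  | [], B => by simp [headPolyTM, addI]
  | q :: A, B => by
      simp only [List.cons_append, headPolyTM]
      rw [headPolyTM_append S rows tms nF ℓ ctr A B, addI_assoc]

/-- The same for the family triples. [folklore] -/
theorem famTriple_append (S : ℕ) (R0 R1 R2 : List IPoly) (tms : List (List IPoly)) (C : EvenCellTM) (A B : List (ℕ × ℕ)) :
    famTriple S R0 R1 R2 tms C (A ++ B) = add3 (famTriple S R0 R1 R2 tms C A) (famTriple S R0 R1 R2 tms C B) := by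
  simp only [famTriple, add3, headPolyTM_append]

/-- The slice `[pos, pos + c)` of a head list. [folklore] -/
def sliceOf (F : List (ℕ × ℕ)) (pos c : ℕ) : List (ℕ × ℕ) := (F.drop pos).take c

/-- Consecutive slices concatenate. [folklore] -/
theorem sliceOf_add (F : List (ℕ × ℕ)) (pos a b : ℕ) : sliceOf F pos (a + b) = sliceOf F pos a ++ sliceOf F (pos + a) b := by
  simp only [sliceOf, List.take_add, List.drop_drop]

/-! ### Group parts -/

/-- The parts form a chain from `pos`: each starts where the previous ended. [folklore] -/
def chainFrom : ℕ → List HeadPartOdd → Bool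
  | _, [] => true
  | pos, p :: ps => decide (p.t0 = pos) && chainFrom (pos + p.count) ps

/-- Total number of terms of a list of parts. [folklore] -/
def countSum : List HeadPartOdd → ℕ
  | [] => 0
  | p :: ps => p.count + countSum ps

/-- The group tiling check: `ps` is a chain from `g.t0` of total length `g.count`. [folklore] -/
def groupTiles (g : HeadPartOdd) (ps : List HeadPartOdd) : Bool :=
  chainFrom g.t0 ps && decide (countSum ps = g.count)

/-- The group claims check: the summed claims of `ps` are contained in the claims of `g` (13 containments; cheap). [folklore] -/
def groupClaimsOK (g : HeadPartOdd) (ps : List HeadPartOdd) : Bool :=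
  subset3 (sumV HeadPartOdd.v3 ps) g.P3 && subset3 (sumV HeadPartOdd.v4 ps) g.P4 && subset3 (sumV HeadPartOdd.v5 ps) g.P5 &&
    subsetI (sumPX (ps.map HeadPartOdd.v0)) g.P0 && subset3 (sumV HeadPartOdd.vt ps) g.Pt

section Group

variable (R : OddHeadRowsΔ) (C : EvenCellTM) (tS tP tM : List (List IPoly))

/-- The five computed objects of a slice, as one tuple (local abbreviation). [folklore] -/
def computed5 (sl : List (ℕ × ℕ)) : ITriple × ITriple × ITriple × IPoly × ITriple :=
  (famTriple R.S (R.rows 0 0) (R.rows 0 1) (R.rows 0 2) tS C sl, famTriple R.S (R.rows 1 0) (R.rows 1 1) (R.rows 1 2) tP C sl,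
    famTriple R.S (R.rows 2 0) (R.rows 2 1) (R.rows 2 2) tP C sl, headPolyTM R.S (R.rows 3 0) tM C.nF C.ℓ C.ctr sl,
    famTriple R.S (R.rows 4 0) (R.rows 4 1) (R.rows 4 2) tP C sl)

/-- **Chained parts that pass `oddPartOKL` enclose the computed objects of their union slice in their summed claims.** [folklore] -/
theorem computed_subset_sumV_of_chain :
    ∀ (ps : List HeadPartOdd) (pos : ℕ), (∀ p ∈ ps, oddPartOKL R C tS tP tM p = true) → chainFrom pos ps = true →
      subset3 (computed5 R C tS tP tM (sliceOf C.F pos (countSum ps))).1 (sumV HeadPartOdd.v3 ps) = true ∧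
      subset3 (computed5 R C tS tP tM (sliceOf C.F pos (countSum ps))).2.1 (sumV HeadPartOdd.v4 ps) = true ∧
      subset3 (computed5 R C tS tP tM (sliceOf C.F pos (countSum ps))).2.2.1 (sumV HeadPartOdd.v5 ps) = true ∧
      subsetI (computed5 R C tS tP tM (sliceOf C.F pos (countSum ps))).2.2.2.1 (sumPX (ps.map HeadPartOdd.v0)) = true ∧
      subset3 (computed5 R C tS tP tM (sliceOf C.F pos (countSum ps))).2.2.2.2 (sumV HeadPartOdd.vt ps) = true
  | [], pos, _, _ => by
      simp [computed5, countSum, sliceOf, famTriple, headPolyTM, sumV, sumPX, sumPY, sumPZ, subset3, subsetI]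
  | p :: ps, pos, hok, hch => by
      simp only [chainFrom, Bool.and_eq_true, decide_eq_true_eq] at hch
      obtain ⟨ht0, hch'⟩ := hch
      obtain ⟨i3, i4, i5, i0, iT⟩ :=
        computed_subset_sumV_of_chain ps (pos + p.count) (fun q hq => hok q (List.mem_cons_of_mem _ hq)) hch'
      have hp := hok p List.mem_cons_self
      simp only [oddPartOKL, Bool.and_eq_true] at hp
      obtain ⟨⟨⟨⟨h3, h4⟩, h5⟩, h0⟩, hT⟩ := hp
      rw [ht0] at h3 h4 h5 h0 hT
      have hs : sliceOf C.F pos (countSum (p :: ps)) = sliceOf C.F pos p.count ++ sliceOf C.F (pos + p.count) (countSum ps) := by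
        simp only [countSum, sliceOf_add]
      simp only [computed5] at i3 i4 i5 i0 iT ⊢
      rw [hs, famTriple_append, famTriple_append, famTriple_append, famTriple_append, headPolyTM_append]
      exact ⟨subset3_add3 h3 i3, subset3_add3 h4 i4, subset3_add3 h5 i5, subsetI_addI h0 i0, subset3_add3 hT iT⟩

/-- **GROUP PART THEOREM, odd head.** A part `g` whose term range is tiled by a chain of parts that each pass the literal-table
check, and whose claims contain the summed claims of the chain, passes `oddPartOKL` — proved, not evaluated. [folklore] -/
theorem oddPartOKL_of_group {g : HeadPartOdd} {ps : List HeadPartOdd} (htile : groupTiles g ps = true)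
    (hparts : ∀ p ∈ ps, oddPartOKL R C tS tP tM p = true) (hclaims : groupClaimsOK g ps = true) :
    oddPartOKL R C tS tP tM g = true := by
  simp only [groupTiles, Bool.and_eq_true, decide_eq_true_eq] at htile
  obtain ⟨hch, hcnt⟩ := htile
  have h := computed_subset_sumV_of_chain R C tS tP tM ps g.t0 hparts hch
  rw [hcnt] at h
  simp only [computed5] at h
  simp only [groupClaimsOK, Bool.and_eq_true] at hclaims
  obtain ⟨⟨⟨⟨g3, g4⟩, g5⟩, g0⟩, gT⟩ := hclaims
  simp only [oddPartOKL, Bool.and_eq_true]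
  exact ⟨⟨⟨⟨subset3_trans h.1 g3, subset3_trans h.2.1 g4⟩, subset3_trans h.2.2.1 g5⟩, subsetI_trans h.2.2.2.1 g0⟩,
    subset3_trans h.2.2.2.2 gT⟩

/-- **GROUP PART THEOREM in the landed form**: with the three table equalities, the group part passes `oddHeadPartOKΔ`.
[folklore] -/
theorem oddHeadPartOKΔ_of_group {t₁ t₂ : ℚ} (hS : C.tmsS R.S t₁ t₂ = tS) (hP : C.tmsP R.S t₁ t₂ = tP) (hM : C.tmsM R.S t₁ t₂ = tM)
    {g : HeadPartOdd} {ps : List HeadPartOdd} (htile : groupTiles g ps = true)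
    (hparts : ∀ p ∈ ps, oddPartOKL R C tS tP tM p = true) (hclaims : groupClaimsOK g ps = true) :
    oddHeadPartOKΔ R C t₁ t₂ g = true :=
  oddHeadPartOKΔ_of_tables hS hP hM (oddPartOKL_of_group R C tS tP tM htile hparts hclaims)

end Group

end Summit.CriticalPhenomena.Ising3D
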